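import Literature.NumberTheory.LFunctions.Zhang2022.KnifeEdgeEllVernierPositivity

/-!
# §D edge ell — card `ell-vernier-far-pair`: the far pair with a FIXED margin `m` (the critics' repair), K4(m) from
# K2♭(m) by the transported Lemma 2.3, and the RESTRICTED vernier detector whose positivity is a THEOREM

Y. Zhang, *Discrete mean estimates and the Landau–Siegel zero*, arXiv:2211.02515v1 [Zhang2022LandauSiegel] — an
unrefereed manuscript under adjudication. **WHAT THIS IS NOT: not a claim about Theorems 1–2 of arXiv:2211.02515,
about Landau–Siegel zeros, about Parity, or about a repaired `Margin232`; the bare `Prop`s below (`VernierPositivityM`,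
`VernierBracketClearAllM`, `VernierClearDict`) are DEFINITIONS asserted by no one. The programme SEARCHES and TYPES;
no claim about Landau–Siegel zeros, Theorems 1–2 of arXiv:2211.02515 or a repaired Margin232 until a kernel theorem
says so.** (LANDAU–SIEGEL programme F-S3, cell `landau-siegel`, §D edge ell; typer ls-knife-typer-2 g3; companion of
`KnifeEdgeEllVernier{,Endgame,Positivity}.lean`.)

## Why
Second reader ls-knife-crit-3 g4 (2026-08-27T00:00:51Z (r2′), concurred by the critic of record ls-knife-crit-2
00:03:36Z): under (A) the far pair is displaced by `≍ θ·log log 𝓛/log 𝓛` gaps — `o(1)` but `≫ 𝓛^{−1/4}` — so the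
card's margin `m = 𝓛^{−1/4}` is mis-set; the repair takes `m` a FIXED constant in `(0, ½]` (crit-3 01:21:46Z: «an
m-parametric twin … lets the card choose m late; adoption is the author's call»). This file supplies the m-parametric
objects, and a second, leaner route shape in which positivity is not a crux at all.

## Contents
* Part 1 — fixed margin: `farLow θ m D p = α̃(J+m)`, `farHigh θ m D p = α̃(J+1−m)`, `cstarVernierM θ m c'`
  (`= cstarPair` at those heights; `cstarVernierM_vernierMargin`: the card's weight is the `m = 𝓛^{−1/4}` member),
  PROVED `farHeights_eventually` (`0 < v ≤ v′ < 2` for `θ ≥ 0`, `0 < m ≤ ½`, `𝓛 ≥ max(16, 2πθ+4)`).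
* Part 2 — K4(m) `VernierPositivityM θ m c'`, K2♭(m) `VernierBracketClearAllM θ m` (OPEN shapes) and PROVED
  `vernierPositivityM_of_bracketClearAll(_closed)` (Lemma 2.3 transported, `cstarPair_pos_at`; Prop. 2.2 by
  `Skeleton.prop22_eventually`).
* Part 3 — the RESTRICTED detector: `clearZeros` (`𝔷♭(ψ)` = zeros whose far bracket is clear), `vernierClearDetector θ m c'
  : DetTemplate.Detector` (family `Ψ₁`, points `𝔷♭(ψ)`, weight `𝔠*_{J,m}·ω`), `vernierClearMean`; PROVED
  `vernierClearWeights_nonneg` / `vernierClearMean_nonneg_eventually` (weights real `≥ 0` at EVERY index, from Prop. 2.2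
  alone — no coherence crux, no (A)); the ONE analytic crux `VernierClearDict θ m c' F μ` (dictionary for the restricted
  mean; the card's K2/P1 content is INSIDE it: «the restricted mean still has main term 𝔞𝔓·𝔅^V»); PROVED
  `eventually_not_assumptionA_of_vernierClearDict`, `theorem1_of_vernierClearDict`, and CLOSED
  **`theorem1_of_vernierClearDict_closed : 0 ≤ θ → 0 < m → m ≤ ½ → ∃ c₀ ≥ 0, ∀ c′ ≥ c₀, VernierClearDict θ m c′ F μ →
  μ < 0 → Theorem1`** — a route shape with exactly TWO cruxes (dictionary, sign).
References: Zhang, arXiv:2211.02515v1, §2 (2.13)–(2.17), Lemma 2.3 and its proof pp. 11–12, Prop. 2.2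
[cite: Zhang2022LandauSiegel, §2 Lemma 2.3 (proof) pp. 11–12; Prop. 2.2; (2.16)].
-/

noncomputable section

open Complex Real Set
open scoped ComplexConjugate

namespace Literature.NumberTheory.LFunctions.Zhang2022.KnifeEdgeEll.Vernier

open Literature.NumberTheory.LFunctions.Zhang2022 Skeleton DetTemplate

variable {D : ℕ} [NeZero D] (χ : DirichletCharacter ℂ D)

/-! ## The far pair with a FIXED margin `m` (second reader's repair (r2′); critic of record concurs 00:03:36Z) -/

/-- Lower far height with fixed margin: `v = α̃(p)·(J(θ,p) + m)`. [cite: Zhang2022LandauSiegel, §2 (2.13)] -/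
def farLow (θ m : ℝ) (D : ℕ) (p : ℝ) : ℝ := alphaFence D p * ((vernierJAt θ D p : ℝ) + m)

/-- Upper far height with fixed margin: `v′ = α̃(p)·(J(θ,p) + 1 − m)`. [cite: Zhang2022LandauSiegel, §2 (2.13)] -/
def farHigh (θ m : ℝ) (D : ℕ) (p : ℝ) : ℝ := alphaFence D p * ((vernierJAt θ D p : ℝ) + 1 - m)

/-- **The vernier weight with a FIXED margin `m`:** `𝔠*_{J,m}(ρ,ψ) = 𝔠*_{v,v′}(ρ,ψ)` at `v = α̃(J+m)`, `v′ = α̃(J+1−m)`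
(`cstarPair`; the card's `cstarVernier θ c'` is the `m = 𝓛^{−1/4}` member). [cite: Zhang2022LandauSiegel, §2 p. 5, (2.13)] -/
def cstarVernierM (θ m c' : ℝ) (D : ℕ) (x : Chr D) (ρ : ℂ) : ℂ :=
  cstarPair c' D x ρ (farLow θ m D x.p) (farHigh θ m D x.p)

omit [NeZero D] in
/-- At `m = vernierMargin D` the fixed-margin weight is the card's weight. [cite: Zhang2022LandauSiegel, §2 (2.13)] -/
theorem cstarVernierM_vernierMargin (θ c' : ℝ) (x : Chr D) (ρ : ℂ) :
    cstarVernierM θ (vernierMargin D) c' D x ρ = cstarVernier θ c' D x ρ := rfl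

/-- `L₀ ≤ log D` once `D ≥ ⌈exp L₀⌉₊`. [cite: Zhang2022LandauSiegel, §2 p. 4] -/
private theorem le_log_of_ceil_exp_le'' {L₀ : ℝ} {D : ℕ} (hD : ⌈Real.exp L₀⌉₊ ≤ D) : L₀ ≤ Real.log D := by
  have h : Real.exp L₀ ≤ D := le_trans (Nat.le_ceil _) (by exact_mod_cast hD)
  exact (Real.le_log_iff_exp_le (lt_of_lt_of_le (Real.exp_pos _) h)).mpr h

/-- **Fixed-margin heights are eventually admissible:** for `θ ≥ 0`, `0 < m ≤ 1/2` and `𝓛 ≥ max(16, 2πθ + 4)`: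
`0 < v ≤ v′ < 2`. [cite: Zhang2022LandauSiegel, §2 (2.6), (2.10), (2.13)] -/
theorem farHeights_eventually {θ m : ℝ} (hθ : 0 ≤ θ) (hm_pos : 0 < m) (hm_half : m ≤ 1 / 2) :
    ForAllLarge fun D _ _ => ∀ x : Chr D,
      0 < farLow θ m D x.p ∧ farLow θ m D x.p ≤ farHigh θ m D x.p ∧ farHigh θ m D x.p < 2 := by
  refine ⟨max 3 ⌈Real.exp (max 16 (2 * π * θ + 4))⌉₊, fun D _ χ hD _ _ x => ?_⟩
  simp only [farLow, farHigh]
  have hD3 : 3 ≤ D := le_trans (le_max_left _ _) hD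
  have hL := le_log_of_ceil_exp_le'' (le_trans (le_max_right _ _) hD)
  have hL16 : 16 ≤ Real.log (D : ℝ) := le_trans (le_max_left _ _) hL
  have hLθ : 2 * π * θ + 4 ≤ Real.log (D : ℝ) := le_trans (le_max_right _ _) hL
  have hπ := Real.pi_pos
  have hπ4 : π < 4 := Real.pi_lt_four
  set L : ℝ := Real.log (D : ℝ) with hLdef
  -- the fence
  have hα := alphaFence_pos hD3 x
  have hαle := alphaFence_le hD3 x
  set a : ℝ := alphaFence D x.p with ha
  have hL9 : L ≤ L ^ 9 := le_self_pow₀ (by linarith) (by norm_num)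
  have hαsmall : a ≤ 1 / 2 := by
    calc a ≤ π / L ^ 9 := hαle
      _ ≤ π / 16 := div_le_div_of_nonneg_left hπ.le (by norm_num) (le_trans hL16 hL9)
      _ ≤ 1 / 2 := by linarith
  -- the gap count: `J ≤ θ·L_Δ/δ`, `δ = ½𝓛 − log 2π ≥ πθ + …`
  set LΔ : ℝ := (EllScales.Scales.pinned D).LDelta x.p with hLΔ
  have hLΔ9 : L ^ 9 ≤ LΔ := ell_pow_nine_le_LDelta hD3 x
  have hLΔpos : 0 < LΔ := lt_of_lt_of_le (by positivity) hLΔ9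
  have haLΔ : a * LΔ = π := by rw [ha, alphaFence, ← hLΔ]; field_simp
  set δ : ℝ := Real.log (Real.sqrt (D : ℝ)) - Real.log (2 * π) with hδ
  have hlog2π : Real.log (2 * π) < 2 := by
    rw [Real.log_lt_iff_lt_exp (by positivity)]
    have he := Real.exp_one_gt_d9
    have hπ3 : π < 3.15 := Real.pi_lt_d2
    have h2 : Real.exp 2 = Real.exp 1 * Real.exp 1 := by rw [← Real.exp_add]; norm_num
    have hee : (2.7182818283 : ℝ) * 2.7182818283 < Real.exp 1 * Real.exp 1 :=
      mul_lt_mul'' he he (by norm_num) (by norm_num)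
    rw [h2]
    linarith
  have hδeq : Real.log (Real.sqrt (D : ℝ)) = L / 2 := by
    rw [hLdef, Real.log_sqrt (by positivity)]
  have hδθ : π * θ < δ := by rw [hδ, hδeq]; nlinarith
  have hδpos : 0 < δ := lt_of_le_of_lt (by positivity) hδθ
  have hp0 : (0 : ℝ) < x.p := by exact_mod_cast x.prime.pos
  have hell1 : (EllScales.Scales.pinned D).ell x.p - 1 = δ / LΔ := by
    rw [hδ, hLΔ]
    have := EllScales.Scales.ell_sub_one (EllScales.Scales.pinned D) (p := (x.p : ℝ)) hp0
      (by show (0 : ℝ) < Real.log D ^ 519; positivity) (by show (0 : ℝ) < ((D : ℕ) : ℝ); positivity)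
      hLΔpos.ne'
    have hDD : (EllScales.Scales.pinned D).D = D := rfl
    rw [hDD] at this
    exact this
  have hJ : (vernierJAt θ D x.p : ℝ) ≤ θ * LΔ / δ := by
    rw [vernierJAt, vernierJ, hell1]
    have hq : 0 ≤ θ / (δ / LΔ) := div_nonneg hθ (div_nonneg hδpos.le hLΔpos.le)
    calc (⌊θ / (δ / LΔ)⌋₊ : ℝ) ≤ θ / (δ / LΔ) := Nat.floor_le hq
      _ = θ * LΔ / δ := by field_simp
  set J : ℝ := (vernierJAt θ D x.p : ℝ) with hJdef
  have hJ0 : 0 ≤ J := Nat.cast_nonneg _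
  have haJ : a * J ≤ 1 := by
    calc a * J ≤ a * (θ * LΔ / δ) := mul_le_mul_of_nonneg_left hJ hα.le
      _ = π * θ / δ := by rw [← haLΔ]; field_simp
      _ ≤ 1 := by rw [div_le_one hδpos]; exact hδθ.le
  refine ⟨by positivity, ?_, ?_⟩
  · exact mul_le_mul_of_nonneg_left (by linarith) hα.le
  · calc a * (J + 1 - m) ≤ a * (J + 1) := mul_le_mul_of_nonneg_left (by linarith) hα.le
      _ = a * J + a := by ring
      _ < 2 := by linarith


/-! ## K4 and K2♭ with a fixed margin, and K4(m) from K2♭(m) -/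

/-- **K4 with fixed margin `m` (OPEN shape):** under (A), eventually, `𝔠*_{J,m}(ρ,ψ)` is real and `≥ 0` at every
coherent pair. [cite: Zhang2022LandauSiegel, §2 Lemma 2.3, (2.13)] -/
def VernierPositivityM (θ m c' : ℝ) : Prop :=
  ForAllLarge fun D _ χ => AssumptionA D χ →
    ∀ x : Chr D, CoherentMember χ x → ∀ ρ ∈ zeroSet D x,
      (cstarVernierM θ m c' D x ρ).im = 0 ∧ 0 ≤ (cstarVernierM θ m c' D x ρ).re

/-- **K2♭ with fixed margin `m` (OPEN shape):** under (A), eventually, at every coherent pair the closed far bracket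
`[Im ρ + α̃(J+m), Im ρ + α̃(J+1−m)]` is free of zeros of `L(s,ψ)L(s,ψχ)` in `Ω` (the second reader's
`VernierBracketClear θ m` with empty exceptional set and closed bracket). [cite: Zhang2022LandauSiegel, §2 Lemma 2.3, (2.13); §4 (4.10)–(4.11)] -/
def VernierBracketClearAllM (θ m : ℝ) : Prop :=
  ForAllLarge fun D _ χ => AssumptionA D χ → ∀ x : Chr D, CoherentMember χ x → ∀ ρ ∈ zeroSet D x,
    BracketClearAt χ x ρ (farLow θ m D x.p) (farHigh θ m D x.p)

/-- **K4(m) is Lemma 2.3 transported (kernel):** Prop. 2.2 at `c′ ≥ 0` and K2♭(m) give `VernierPositivityM θ m c'`,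
for `θ ≥ 0`, `0 < m ≤ 1/2`. [cite: Zhang2022LandauSiegel, §2 Lemma 2.3 (proof) pp. 11–12, Prop. 2.2] -/
theorem vernierPositivityM_of_bracketClearAll {θ m c' : ℝ} (hθ : 0 ≤ θ) (hm : 0 < m) (hm' : m ≤ 1 / 2)
    (hc' : 0 ≤ c') (h22 : Prop22 c') (hB : VernierBracketClearAllM θ m) : VernierPositivityM θ m c' := by
  have hP := forAllLarge_of_prop22 h22 (S := fun D _ χ => ∀ x ∈ PsiOne χ,
      (∀ s ∈ prodZeroSetOmega χ x, s.re = 1 / 2) ∧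
      (∀ s ∈ prodZeroSetOmega χ x, deriv (fun w => x.ψ.LFunction w * (psiChi χ x).LFunction w) s ≠ 0) ∧
      (∀ s ∈ prodZeroSetOmega χ x, ∀ s' ∈ prodZeroSetOmega χ x, s.im < s'.im →
        (∀ s'' ∈ prodZeroSetOmega χ x, ¬ (s.im < s''.im ∧ s''.im < s'.im)) →
          |s'.im - s.im - alpha D| < c' * alpha D ^ 2 * ell D) ∧
      (3 ≤ D ∧ χ.IsPrimitive ∧ 5 * c' * alpha D * ell D < 1 ∧ alpha D ≤ 1 / 2))
    (fun D _ χ hD hp hsmall hαhalf h x hx => ⟨(h x hx).1, (h x hx).2.1, (h x hx).2.2, hD, hp, hsmall, hαhalf⟩)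
  refine ((hP.and (farHeights_eventually hθ hm hm')).and hB).mono ?_
  intro D _ χ _ _ h hA x hx ρ hρ
  obtain ⟨⟨hP', hH⟩, hB'⟩ := h
  obtain ⟨h_i, h_ii, h_iii, hD3, hp, hsmall, hαhalf⟩ := hP' x hx.1
  obtain ⟨hv, hvv', hv'2⟩ := hH x
  have hpos := cstarPair_pos_at χ hD3 hp hc' hsmall hαhalf x h_i h_ii h_iii hρ hv hvv' hv'2
    (hB' hA x hx ρ hρ)
  exact ⟨hpos.1, hpos.2.le⟩

/-- … closed in `c′` (Prop. 2.2 by `Skeleton.prop22_eventually`). [cite: Zhang2022LandauSiegel, §2 Lemma 2.3, Prop. 2.2] -/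
theorem vernierPositivityM_of_bracketClearAll_closed {θ m : ℝ} (hθ : 0 ≤ θ) (hm : 0 < m) (hm' : m ≤ 1 / 2)
    (hB : VernierBracketClearAllM θ m) : ∃ c₀ : ℝ, 0 ≤ c₀ ∧ ∀ c' : ℝ, c₀ ≤ c' → VernierPositivityM θ m c' := by
  obtain ⟨c₀, h0, h⟩ := prop22_eventually
  exact ⟨c₀, h0, fun c' hc' => vernierPositivityM_of_bracketClearAll hθ hm hm' (h0.trans hc') (h c' hc') hB⟩

/-! ## The RESTRICTED vernier detector: sample only the zeros whose far bracket is clear — positivity is then a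
THEOREM (no coherence crux), and the whole analytic burden sits in ONE dictionary -/

/-- **The bracket-clear zeros of `ψ`:** `𝔷♭(ψ) = {ρ ∈ 𝔷(ψ) : [Im ρ + α̃(J+m), Im ρ + α̃(J+1−m)] free of zeros of
L(s,ψ)L(s,ψχ) in Ω}`. [cite: Zhang2022LandauSiegel, §2 (2.14), Lemma 2.3] -/
def clearZeros (θ m : ℝ) (x : Chr D) : Set ℂ :=
  {ρ | ρ ∈ zeroSet D x ∧ BracketClearAt χ x ρ (farLow θ m D x.p) (farHigh θ m D x.p)}

/-- **The restricted vernier detector** (B-det template datum): family `Ψ₁`, sampled points `𝔷♭(ψ)` (bracket-clear zeros),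
weight `𝔠*_{J,m}(ρ,ψ)·ω(ρ)`. [cite: Zhang2022LandauSiegel, §2 (2.14)–(2.16), Lemma 2.3] -/
def vernierClearDetector (θ m c' : ℝ) : Detector where
  fam := fun _ _ χ => PsiOne χ
  pts := fun _ _ χ x => clearZeros χ θ m x
  wt := fun D _ _ x ρ => cstarVernierM θ m c' D x ρ * omegaW D ρ

/-- **The restricted vernier mean** `Ξ♭_J(F) = Σ_{ψ ∈ Ψ₁} Σ_{ρ ∈ 𝔷♭(ψ)} Re 𝔠*_{J,m}(ρ,ψ)·‖F(ψ,ρ)‖²·Re ω(ρ)`.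
[cite: Zhang2022LandauSiegel, §2 (2.16)–(2.17)] -/
def vernierClearMean (θ m c' : ℝ) (F : Chr D → ℂ → ℂ) : ℝ :=
  ∑ i ∈ (vernierClearDetector θ m c').idx χ,
    (cstarVernierM θ m c' D i.1 i.2).re * ‖F i.1 i.2‖ ^ 2 * (omegaW D i.2).re

variable {χ}

omit [NeZero D] in
/-- Membership in the restricted index set. [cite: Zhang2022LandauSiegel, §2 (2.16)] -/
theorem mem_of_mem_clearIdx [NeZero D] {θ m c' : ℝ} {i : (_ : Chr D) × ℂ}
    (hi : i ∈ (vernierClearDetector θ m c').idx χ) :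
    i.1 ∈ PsiOne χ ∧ i.2 ∈ zeroSet D i.1 ∧ BracketClearAt χ i.1 i.2 (farLow θ m D i.1.p) (farHigh θ m D i.1.p) := by
  obtain ⟨hx, hρ⟩ := Finset.mem_sigma.mp hi
  have h2 : i.2 ∈ clearZeros χ θ m i.1 := mem_of_mem_finsetOf hρ
  exact ⟨mem_of_mem_finsetOf hx, h2.1, h2.2⟩

/-- **The restricted detector's weights are real and `≥ 0` — a THEOREM** (no coherence hypothesis, no (A)): for
`θ ≥ 0`, `0 < m ≤ 1/2`, `c′ ≥ 0` with Prop. 2.2 at `c′`, eventually in `D`, at every index of the restricted double sum.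
[cite: Zhang2022LandauSiegel, §2 Lemma 2.3 (proof) pp. 11–12, Prop. 2.2 (i), (2.15)] -/
theorem vernierClearWeights_nonneg {θ m c' : ℝ} (hθ : 0 ≤ θ) (hm : 0 < m) (hm' : m ≤ 1 / 2) (hc' : 0 ≤ c')
    (h22 : Prop22 c') :
    ForAllLarge fun D _ χ => ∀ i ∈ (vernierClearDetector θ m c').idx χ,
      ((cstarVernierM θ m c' D i.1 i.2).im = 0 ∧ (omegaW D i.2).im = 0) ∧
        0 ≤ (cstarVernierM θ m c' D i.1 i.2).re * (omegaW D i.2).re := by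
  have hP := forAllLarge_of_prop22 h22 (S := fun D _ χ => ∀ x ∈ PsiOne χ,
      (∀ s ∈ prodZeroSetOmega χ x, s.re = 1 / 2) ∧
      (∀ s ∈ prodZeroSetOmega χ x, deriv (fun w => x.ψ.LFunction w * (psiChi χ x).LFunction w) s ≠ 0) ∧
      (∀ s ∈ prodZeroSetOmega χ x, ∀ s' ∈ prodZeroSetOmega χ x, s.im < s'.im →
        (∀ s'' ∈ prodZeroSetOmega χ x, ¬ (s.im < s''.im ∧ s''.im < s'.im)) →
          |s'.im - s.im - alpha D| < c' * alpha D ^ 2 * ell D) ∧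
      (3 ≤ D ∧ χ.IsPrimitive ∧ 5 * c' * alpha D * ell D < 1 ∧ alpha D ≤ 1 / 2))
    (fun D _ χ hD hp hsmall hαhalf h x hx => ⟨(h x hx).1, (h x hx).2.1, (h x hx).2.2, hD, hp, hsmall, hαhalf⟩)
  refine (hP.and (farHeights_eventually hθ hm hm')).mono ?_
  intro D _ χ _ _ h i hi
  obtain ⟨hP', hH⟩ := h
  obtain ⟨hx, hρ, hclear⟩ := mem_of_mem_clearIdx hi
  obtain ⟨h_i, h_ii, h_iii, hD3, hp, hsmall, hαhalf⟩ := hP' i.1 hx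
  obtain ⟨hv, hvv', hv'2⟩ := hH i.1
  obtain ⟨him, hre⟩ := cstarPair_pos_at χ hD3 hp hc' hsmall hαhalf i.1 h_i h_ii h_iii hρ hv hvv' hv'2 hclear
  have hline : i.2.re = 1 / 2 := h_i i.2 (mem_prodZeroSetOmega_of_mem_zeroSet χ hρ)
  obtain ⟨hωre, hωim⟩ := omegaW_re_pos hD3 hline
  exact ⟨⟨him, hωim⟩, mul_nonneg hre.le hωre.le⟩

/-- … hence the restricted mean is `≥ 0` for every value table, eventually (no (A), no coherence).
[cite: Zhang2022LandauSiegel, §2 (2.16), Lemma 2.3] -/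
theorem vernierClearMean_nonneg_eventually {θ m c' : ℝ} (hθ : 0 ≤ θ) (hm : 0 < m) (hm' : m ≤ 1 / 2)
    (hc' : 0 ≤ c') (h22 : Prop22 c') :
    ForAllLarge fun D _ χ => ∀ F : Chr D → ℂ → ℂ, 0 ≤ vernierClearMean χ θ m c' F := by
  refine (vernierClearWeights_nonneg hθ hm hm' hc' h22).mono ?_
  intro D _ χ _ _ h F
  unfold vernierClearMean
  refine Finset.sum_nonneg fun i hi => ?_
  have := mul_nonneg (h i hi).2 (sq_nonneg ‖F i.1 i.2‖)
  nlinarith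

/-- **The restricted vernier DICTIONARY** (ONE analytic crux; OPEN shape, value table `F` and constant `μ` are the slots
D1 fills): `Ξ♭_J(F_D,χ) = 𝔞𝔓(μ + o(1))` under (A), eventually. It absorbs the card's K2/P1: the excluded pairs and their
cost are inside the claim that the RESTRICTED mean has this main term. [cite: Zhang2022LandauSiegel, §2 (2.31)–(2.33); §8 (8.23)] -/
def VernierClearDict (θ m c' : ℝ) (F : ValueTable) (μ : ℝ) : Prop :=
  ∀ ε : ℝ, 0 < ε → ForAllLarge fun D _ χ => AssumptionA D χ →
    |vernierClearMean χ θ m c' (F D χ) - μ * frakA χ * frakP D| ≤ ε * frakA χ * frakP D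

/-- **The restricted endgame:** dictionary with NEGATIVE constant ⇒ (A) fails for every large modulus — positivity
being a theorem here (`vernierClearMean_nonneg_eventually`), the only displayed inputs are the dictionary, the sign, and
Prop. 2.2 at `c′`. [cite: Zhang2022LandauSiegel, §2 p. 6, (2.16), Lemma 2.3] -/
theorem eventually_not_assumptionA_of_vernierClearDict {θ m c' μ : ℝ} {F : ValueTable} (hθ : 0 ≤ θ) (hm : 0 < m)
    (hm' : m ≤ 1 / 2) (hc' : 0 ≤ c') (h22 : Prop22 c') (hdict : VernierClearDict θ m c' F μ) (hμ : μ < 0) :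
    ∃ D₀ : ℕ, ∀ (D : ℕ) [NeZero D] (χ : DirichletCharacter ℂ D),
      D₀ ≤ D → χ.IsQuadratic → χ.IsPrimitive → ¬ AssumptionA D χ := by
  have hε : 0 < -μ / 3 := by linarith
  obtain ⟨D₁, h₁⟩ := (vernierClearMean_nonneg_eventually hθ hm hm' hc' h22).and (hdict (-μ / 3) hε)
  obtain ⟨a₀, ha₀, D₂, h₂⟩ := frakALowerBound_holds
  obtain ⟨D₃, h₃⟩ := frakP_eventually_pos
  refine ⟨max D₁ (max D₂ D₃), fun D _ χ hD hq hp hA => ?_⟩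
  have hD₁ : D₁ ≤ D := le_trans (le_max_left _ _) hD
  have hD₂ : D₂ ≤ D := le_trans (le_trans (le_max_left _ _) (le_max_right _ _)) hD
  have hD₃ : D₃ ≤ D := le_trans (le_trans (le_max_right _ _) (le_max_right _ _)) hD
  obtain ⟨hpos, hd⟩ := h₁ D χ hD₁ hq hp
  have hl := hpos (F D χ)
  have hd' := (abs_le.mp (hd hA)).2
  have hA0 : 0 < frakA χ := lt_of_lt_of_le ha₀ (h₂ D χ hD₂ hq hp hA)
  have hP0 : 0 < frakP D := h₃ D hD₃
  have hX : 0 < frakA χ * frakP D := mul_pos hA0 hP0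
  nlinarith

/-- **⇒ Theorem 1, restricted form:** `VernierClearDict θ m c' F μ → μ < 0 → Theorem1` (given `θ ≥ 0`, `0 < m ≤ 1/2`,
`c′ ≥ 0`, Prop. 2.2 at `c′`). [cite: Zhang2022LandauSiegel, §1 Theorem 1; §2 p. 6] -/
theorem theorem1_of_vernierClearDict {θ m c' μ : ℝ} {F : ValueTable} (hθ : 0 ≤ θ) (hm : 0 < m) (hm' : m ≤ 1 / 2)
    (hc' : 0 ≤ c') (h22 : Prop22 c') (hdict : VernierClearDict θ m c' F μ) (hμ : μ < 0) : Theorem1 :=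
  Skeleton.theorem1_of_eventually_not_assumptionA
    (eventually_not_assumptionA_of_vernierClearDict hθ hm hm' hc' h22 hdict hμ)

/-- **… CLOSED in `c′`:** for `θ ≥ 0`, `0 < m ≤ 1/2` there is `c₀ ≥ 0` with: for all `c′ ≥ c₀`,
`VernierClearDict θ m c' F μ → μ < 0 → Theorem1` — TWO displayed cruxes (dictionary, sign), nothing else.
[cite: Zhang2022LandauSiegel, §1 Theorem 1; §2 Lemma 2.3, Prop. 2.2] -/
theorem theorem1_of_vernierClearDict_closed {θ m : ℝ} (hθ : 0 ≤ θ) (hm : 0 < m) (hm' : m ≤ 1 / 2) :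
    ∃ c₀ : ℝ, 0 ≤ c₀ ∧ ∀ c' : ℝ, c₀ ≤ c' → ∀ {μ : ℝ} {F : ValueTable},
      VernierClearDict θ m c' F μ → μ < 0 → Theorem1 := by
  obtain ⟨c₀, h0, h⟩ := prop22_eventually
  exact ⟨c₀, h0, fun c' hc' _ _ hdict hμ =>
    theorem1_of_vernierClearDict hθ hm hm' (h0.trans hc') (h c' hc') hdict hμ⟩

end Literature.NumberTheory.LFunctions.Zhang2022.KnifeEdgeEll.Vernier

end
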